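import Literature.MathematicalPhysics.QuantumFieldTheory.Balaban1983to89.B9B8KnitLetterRBound

/-!
# `Balaban1983to89.B9B8KnitLetterHprimeBounds` — [B8] (1.92) FOR `H′ = G′²Q′*(Q′G′²Q′*)⁻¹` AT THE KNIT LETTER `parKnitY`: the sup line `|H′X| ≦ B₀|X|`
# and the weighted-gradient line `(Lʲη)|∇^η_U H′X| ≦ B₀|X|`, from the (3.42)₁ ∕ (3.42)₂ block majorants of `η²G′(U; parKnitY)` and the (3.48)-shape
# block majorant of `(Q′G′²Q′*)⁻¹(U; parKnitY)` — the half-word `X·G′·Q′*·(Q′G′²Q′*)⁻¹` typed between its carriers ([B9] p. 399 «using again Lemma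
# 2.1»), read back into `M_N(ℂ)` by a two-space block decomposition — the consumer's laws (E6) `hp_sup` and (E7) `hp_grad` of
# `B8Thm2TorusLetters.LettersAt` at print's own transporters (junction J-B file 18)

statement-level skeleton of published theorems with citation tags; proofs where landed; nothing here is a claim about the
Yang–Mills mass gap

T. Bałaban, *Spaces of regular gauge field configurations on a lattice and gauge fixing conditions*, Commun. Math. Phys. **99** (1985) 75–102
[`Balaban1985RegularSpaces`, "[B8]"]; T. Bałaban, *Propagators for lattice gauge theories in a background field*, Commun. Math. Phys. **99** (1985) 389–434
[`Balaban1985BackgroundPropagators`, "[B9]"]; T. Bałaban, *Propagators and renormalization transformations for lattice gauge theories. II*, Commun. Math.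
Phys. **96** (1984) 223–250 [`Balaban1984PropagatorsII`, "[4]"].

THE PRINT.  [B8] (1.91) p. 91: `H′ = G′²Q′*(Q′G′²Q′*)⁻¹`, *«They were investigated in [4], and the following inequality can be obtained from the results of
this paper: |H′X|, (Lʲη)|∇^η_{U₀}H′X|, (Lʲη)²|Δ^η_{U₀}H′X| ≦ B₀|X| for x ∈ Ω_j (1.92)»* (display restored from the consumer's typed record), p. 92: *«where
(H′X)(x) = Σ_{y′}(L^{j′}η)^dH′(x, y′)X(y′), and B₀ is an absolute constant (depending on d and L only)»* — the consumer's laws (E6) `hp_sup`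
(`‖H′X(x)‖ ≦ B₀′_H‖X‖`) and (E7) `hp_grad` (`(Lʲη)‖D^η_{U₀,μ}(H′X)(x)‖ ≦ B₀′_H‖X‖`, `j ≦ n`) of `B8Thm2TorusLetters.LettersAt`.  [B9] Theorem 3.1 (3.42)₁,₂
p. 397 (the kernels of `G′`, `∇_UG′`), Theorem 3.2 (3.48) p. 398 (the kernel of `(Q′G′²Q′*)⁻¹`), p. 398 (scale transfer), p. 399 (3.49) «using again Lemma
2.1» (the composition device); [4] (2.51)–(2.52) p. 232, Lemma 2.1 (2.61) p. 234.

WHY THIS FILE ∕ THE ARGUMENT.  In p21's real coordinates `H′ = G′·G′·Q′*·(Q′G′²Q′*)⁻¹` is the two-space word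
`conj b(η²G′) ∘ conj b(η²G′) ∘ conjHom b(Q′*) ∘ conj b(s·(Q′G′²Q′*)⁻¹)` from the block carrier to the site carrier (`η²·η²·s = 1`: `H′` is unit-free).
With the (3.42)₁ majorant `A·ℓ²·e^{−δd}` of `conj b(η²G′(U; parKnitY))` (junction file 15), `Q′*` block-local of norm `M₂Σ‖b_j‖` (M5.6 FILE 3b), and the
(3.48)-shape majorant `K·ℓ⁻⁴·e^{−δd}` of `conj b(s·(Q′G′²Q′*)⁻¹(U; parKnitY))` (M5.6's output shape at `parS := parKnitY`), two applications of r06's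
`hasMajorantHom_comp_decay` ([4] (2.52) + (2.61) + the p. 398 scale transfer) give the LEVEL-FREE two-space majorant `κ_H·e^{−ρd}` (`ℓ²·ℓ²·ℓ⁻⁴ = 1`);
with a first factor `conj b(η⁻¹∇_{U,μ})·conj b(η²G′) ≺ A₁·ℓ·e^{−δd}` ((3.42)₂, junction file 16's shape) instead, `κ_∇·ℓ⁻¹·e^{−ρd}`.  A two-space block
decomposition ([4] (2.52), the `Hom` twin of junction file 11's reading) turns these into `‖(H′Y)(z)‖ ≦ (Σ‖b_j‖)κ_H c M₂·sup‖Y‖` and, on a constant-level-`n`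
member (`ℓ = Lⁿη`), `Lⁿ‖(∇_{U,μ}H′Y)(z)‖ ≦ (Σ‖b_j‖)κ_∇ c M₂·sup‖Y‖` — the consumer's two lines with `B₀′_H` free of the member, `n`, `k`, `N`, `η`.

CITATION HEADER (lean-in-tree rule).  Cell `lit-balaban`, sub-row G-B9-LETTERS, junction J-B file 18 → seat `lit-balaban-p33` gen 95.  REUSED BY NAME: pv21
`B6RandomWalkHom.{HasMajorantHom, hasMajorantHom_iff, hasMajorantHom_mono}`, `B6RandomWalk.{blockPiece, sum_blockPiece, BlockSupp}`, r06 `B9Ineq349Hom.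
{hasMajorantHom_comp_decay, hasMajorantHom_local_comp, hasMajorantHom_rate_mono}`, p21 `B9Thm39CinvSandwichQ.hasMajorantHom_conjHom_QpsY`,
`B9Eq352DivFormLetters.{conj, coordEquiv, gradLetterF}`, `B9Eq376POneLetters.{conjHom, conjHom_comp, conjHom_eq_conj, conjHom_apply}`, `B9Eq352GradLetters.
diffLetter`, n06-j `B9CoReadingCoords.norm_le_basisBound_mul`, def-Y `Node00.{GpY, QpsY, XinvY, cdS}`, junction file 17 (`parKnitY_contractive`,
`geo9K_len_constLev`, `scaleTransfer_of_constLev`).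

WHAT THIS FILE PROVES (sorry-free; no definitions; the block majorants and the geometry are DISPLAYED HYPOTHESES of the printed shapes).
* §1 two-space reading ([4] (2.52)): `abs_le_sum_of_hasMajorantHom` (generic), ★ `norm_hom_apply_le_of_hasMajorantHom_sup` ∕ `_exp` (block carrier → site
  carrier, real basis, row sum).
* §2 generic letters `parS`, `Gp`: `smul_halfword_restrictScalars`, `conjHom_halfword`, `smul_gradHalfword_restrictScalars`, `conjHom_gradHalfword`, ★★
  `hasMajorantHom_leftFactor_halfword` (ANY first factor `X₁ ≺ A₁w(a)e^{−δd}`: `X₁ ∘ conj b(tG′) ∘ conjHom b(Q′*) ∘ conj b(sX⁻¹) ≺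
  (M₂Σ‖b_j‖)A₁AKΛ²c₁² · w·ℓ²·ℓ⁻⁴ · e^{−ρd}` for `ρ + 2(α+β)δ₀ ≦ δ`), ★★ `hasMajorantHom_conj_Hprime` (`κ_H·e^{−ρd}`), ★★ `hasMajorantHom_conj_gradHprime`
  (`κ_∇·ℓ⁻¹·e^{−ρd}`).
* §3 at the knit letter: ★★ `hasMajorantHom_conj_Hprime_parKnitY`, ★★★ **`knit_E6`** (`‖(H′Y)(z)‖ ≦ (Σ‖b_j‖)κ_H c M₂·M` for `‖Y(s)‖ ≦ M`), `knit_E6_constLev`,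
  ★★ `hasMajorantHom_conj_gradHprime_parKnitY`, ★★★ **`knit_E7_constLev`** (`Lʲ‖(∇_{U,μ}H′Y)(z)‖ ≦ (Σ‖b_j‖)κ_∇ c M₂·M`, `j ≦ n`; with the consumer's `η′`:
  `(Lʲη′)·η′⁻¹·‖∇_{U,μ}(H′Y)(z)‖ ≦ …`).

HONEST SCOPE.  Bookkeeping in [4]'s block-majorant calculus; the (3.42)₁,₂ majorants at the knit letter (suppliers: junction files 15 ∕ 16 from M5.5's cube
data) and the (3.48)-shape majorant of `s·(Q′G′²Q′*)⁻¹(U; parKnitY)` (supplier: M5.6 at `parS := parKnitY`, its displayed data there) are HYPOTHESES here,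
as are (2.54), (2.61), the scale transfers (free on a constant-level member) and the row sum; the `(−2)`-weighted Laplacian line of (1.92) ((E8)) is NOT in
this file.  Count-neutral; nothing continuum, nothing about OS axioms or the mass gap.  No `sorry`, no `axiom`, no `instance`, no `notation`.  NEW file;
nothing landed is modified.  Net new unproved facts: 0.  Seat `lit-balaban-p33` gen 95, 2026-08-28.
-/

noncomputable section

namespace Literature.MathematicalPhysics.QuantumFieldTheory.Balaban1983to89.B9B8KnitLetterHprimeBounds

open Node00 B6KLevelCensusIndexV1 B6Geom246MultiLevelBox B9BackgroundsKLevelV1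
open B6RandomWalk (HasMajorant BlockSupp blockPiece sum_blockPiece Triangle254 Ineq261 hasMajorant_mono c1_nonneg)
open B6RandomWalkHom (HasMajorantHom hasMajorantHom_mono hasMajorantHom_iff)
open B9Thm34Ext (toB6)
open B9GeoNormsKLevelV1 (geo9K geo9K_len_kGeo)
open B9Eq352DivFormLetters (coordEquiv coordEquiv_apply conj conj_apply gradLetterF gradLetterF_apply)
open B9Eq352GradLetters (diffLetter diffLetter_inl)
open B9Eq376POneLetters (conjHom conjHom_apply conjHom_comp conjHom_eq_conj)
open B9CoReadingCoords (norm_le_basisBound_mul)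
open B9Ineq347 (ScaleTransfer)
open B9Ineq349Hom (hasMajorantHom_comp_decay hasMajorantHom_local_comp hasMajorantHom_rate_mono)
open B9Thm39CinvSandwichQ (hasMajorantHom_conjHom_QpsY)
open B9Ineq349SiteComposite (etaS_pos)
open B6Prop22KLevelTorusCensusEta (nKT)
open B6Ineq2142KLevelV1 (β lvl beta_level)
open B9B8AveragingJunction (parKnitY levY_of_blkOf)
open B9B8KnitLetterRBound (parKnitY_contractive geo9K_len_constLev scaleTransfer_of_constLev)
open scoped Matrix Matrix.Norms.L2Operator

variable {d ℓ : ℕ} {hd : 1 ≤ d + 1} {hL : Odd (ℓ + 1) ∧ 1 < ℓ + 1} {b₀ b₁ : ℝ}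
variable (i : KIdx d ℓ hd hL b₀ b₁)

/-! ## §1 Two-space reading: from a block-carrier → site-carrier majorant of `conjHom b T` to a sup-norm bound of `T` ([4] (2.52)) -/

section Reading

/-- **[4] (2.52) FOR A TWO-SPACE LETTER**: `f = Σ_{y′}Δ(y′)f` on the source lattice, so `|(Tf)(v)| ≦ Σ_{y′}K(y(v), y′)·U(y′)` whenever `|f| ≦ U(y(·))`.
[cite: Balaban1984PropagatorsII, (2.51)–(2.52) p.232] -/
theorem abs_le_sum_of_hasMajorantHom {g : B6.Geometry} {X Y : Type} (blkX : X → g.Site) (blkY : Y → g.Site)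
    {T : (X → ℝ) →ₗ[ℝ] (Y → ℝ)} {K : g.Site → g.Site → ℝ} (hT : HasMajorantHom blkX blkY T K) (f : X → ℝ) (U : g.Site → ℝ)
    (hU0 : ∀ a, 0 ≤ U a) (hU : ∀ x, |f x| ≤ U (blkX x)) (v : Y) : |T f v| ≤ ∑ a, K (blkY v) a * U a := by
  classical
  have hf : f = ∑ a, blockPiece blkX a f := (sum_blockPiece blkX f).symm
  have hpiece : ∀ a, BlockSupp blkX (blockPiece blkX a f) a (U a) := fun a =>
    { nonneg := hU0 a
      bound := fun x hx => by
        simp only [blockPiece, hx, if_true]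
        exact hx ▸ hU x
      off := fun x hx => by simp only [blockPiece, hx, if_false] }
  have hTf : T f = ∑ a, T (blockPiece blkX a f) := by
    conv_lhs => rw [hf]
    rw [map_sum]
  calc |T f v| = |(∑ a, T (blockPiece blkX a f)) v| := by rw [hTf]
    _ = |∑ a, T (blockPiece blkX a f) v| := by rw [Finset.sum_apply]
    _ ≤ ∑ a, |T (blockPiece blkX a f) v| := Finset.abs_sum_le_sum_abs _ _
    _ ≤ ∑ a, K (blkY v) a * U a := Finset.sum_le_sum fun a _ => hT a _ _ (hpiece a) v

variable {𝔸 : Type} [NormedRing 𝔸] [NormedAlgebra ℂ 𝔸] [CompleteSpace 𝔸]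
variable {ι : Type} [Fintype ι] (b : Module.Basis ι ℝ 𝔸)
variable [Fintype (geo9K i).Site] {Rr : ℝ} {Hp : Prop} (ιB : BlkY i → IBondY i)

omit [CompleteSpace 𝔸] in
/-- ★ **A BLOCK → SITE LETTER READ BACK INTO `𝔸`**: a two-space majorant `K` of `conjHom b T` from the block carrier (`(s, j) ↦ ιB s`) to the site carrier
(`(z, j) ↦ ιB(Δ(z))`) and a real basis with `|b.repr v j| ≦ M₂‖v‖` bound `T : (blocks → 𝔸) → (sites → 𝔸)` in sup norm:
`‖(TY)(z)‖ ≦ (Σ_j‖b_j‖)·(Σ_{a′}K(ιB(Δ(z)), a′))·M₂·M` whenever `‖Y(s)‖ ≦ M` for all `s` (p. 92 «(H′X)(x) = Σ_{y′}(L^{j′}η)^dH′(x, y′)X(y′)»).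
[cite: Balaban1984PropagatorsII, (2.51)–(2.52) p.232; Balaban1985RegularSpaces, p.92] -/
theorem norm_hom_apply_le_of_hasMajorantHom_sup (T : (BlkY i → 𝔸) →ₗ[ℝ] (SiteY i → 𝔸)) {K : (geo9K i).Site → (geo9K i).Site → ℝ}
    (hT : HasMajorantHom (g := toB6 (geo9K i) Rr Hp) (fun q : BlkY i × ι => ιB q.1) (fun p : SiteY i × ι => ιB (blkOf i.D.toDomains p.1)) (conjHom b T) K)
    {M₂ : ℝ} (hM₂ : 0 ≤ M₂) (hrepr : ∀ (v : 𝔸) (j : ι), |b.repr v j| ≤ M₂ * ‖v‖)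
    (Y : BlkY i → 𝔸) {M : ℝ} (hY : ∀ s, ‖Y s‖ ≤ M) (z : SiteY i) :
    ‖T Y z‖ ≤ (∑ j, ‖b j‖) * ((∑ a' : (geo9K i).Site, K (ιB (blkOf i.D.toDomains z)) a') * (M₂ * M)) := by
  classical
  have hM : 0 ≤ M := (norm_nonneg _).trans (hY (blkOf i.D.toDomains z))
  have hμ : ∀ q : BlkY i × ι, |coordEquiv b Y q| ≤ (fun _ : (geo9K i).Site => M₂ * M) (ιB q.1) := fun q => by
    rw [coordEquiv_apply]
    exact (hrepr _ _).trans (mul_le_mul_of_nonneg_left (hY q.1) hM₂)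
  have hco : ∀ j : ι, |b.repr (T Y z) j| ≤ (∑ a' : (geo9K i).Site, K (ιB (blkOf i.D.toDomains z)) a') * (M₂ * M) := by
    intro j
    have h := abs_le_sum_of_hasMajorantHom (g := toB6 (geo9K i) Rr Hp) (fun q : BlkY i × ι => ιB q.1)
      (fun p : SiteY i × ι => ιB (blkOf i.D.toDomains p.1)) hT (coordEquiv b Y) (fun _ => M₂ * M) (fun _ => mul_nonneg hM₂ hM) hμ (z, j)
    rw [conjHom_apply, LinearEquiv.symm_apply_apply, ← Finset.sum_mul] at h
    exact h
  exact norm_le_basisBound_mul b _ hco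

omit [CompleteSpace 𝔸] in
/-- ★ **… WITH A WEIGHTED EXPONENTIAL KERNEL AND THE ROW SUM (2.61)**: for the two-space majorant `C·P(a)·e^{−δd(a,a′)}` (`C, P ≧ 0`) and `Σ_{a′}e^{−δd(a,a′)} ≦ c`:
`‖(TY)(z)‖ ≦ (Σ_j‖b_j‖)·C·P(ιB(Δ(z)))·c·M₂·M`. [cite: Balaban1984PropagatorsII, (2.51)–(2.52) p.232, Lemma 2.1 (2.61) p.234; Balaban1985RegularSpaces, (1.92) p.91] -/
theorem norm_hom_apply_le_of_hasMajorantHom_exp (T : (BlkY i → 𝔸) →ₗ[ℝ] (SiteY i → 𝔸)) {C δ c : ℝ} {P : (geo9K i).Site → ℝ} (hC : 0 ≤ C)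
    (hP : ∀ a, 0 ≤ P a)
    (hT : HasMajorantHom (g := toB6 (geo9K i) Rr Hp) (fun q : BlkY i × ι => ιB q.1) (fun p : SiteY i × ι => ιB (blkOf i.D.toDomains p.1)) (conjHom b T)
      (fun a a' => C * P a * Real.exp (-(δ * (geo9K i).dist a a'))))
    (hrow : ∀ a : (geo9K i).Site, ∑ a' : (geo9K i).Site, Real.exp (-(δ * (geo9K i).dist a a')) ≤ c)
    {M₂ : ℝ} (hM₂ : 0 ≤ M₂) (hrepr : ∀ (v : 𝔸) (j : ι), |b.repr v j| ≤ M₂ * ‖v‖)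
    (Y : BlkY i → 𝔸) {M : ℝ} (hY : ∀ s, ‖Y s‖ ≤ M) (z : SiteY i) :
    ‖T Y z‖ ≤ (∑ j, ‖b j‖) * (C * P (ιB (blkOf i.D.toDomains z)) * c * (M₂ * M)) := by
  have hM : 0 ≤ M := (norm_nonneg _).trans (hY (blkOf i.D.toDomains z))
  have hSb : 0 ≤ ∑ j, ‖b j‖ := Finset.sum_nonneg fun _ _ => norm_nonneg _
  refine (norm_hom_apply_le_of_hasMajorantHom_sup i b ιB T hT hM₂ hrepr Y hY z).trans (mul_le_mul_of_nonneg_left ?_ hSb)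
  refine mul_le_mul_of_nonneg_right ?_ (mul_nonneg hM₂ hM)
  rw [← Finset.mul_sum]
  exact mul_le_mul_of_nonneg_left (hrow _) (mul_nonneg hC (hP _))

end Reading

/-! ## §2 Generic letters: the half-word `X₁·G′·Q′*·(Q′G′²Q′*)⁻¹` from the block carrier to the site carrier -/

section Generic

variable {𝔸 : Type} [NormedRing 𝔸] [NormedAlgebra ℂ 𝔸] [CompleteSpace 𝔸]
variable {ι : Type} [Fintype ι] (b : Module.Basis ι ℝ 𝔸)
variable [Fintype (geo9K i).Site] [DecidableEq (geo9K i).Site] {Rr : ℝ} {Hp : Prop} (ιB : BlkY i → IBondY i)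
variable (parS : SiteParY 𝔸 i) (Gp : SiteOpY 𝔸 i) (U : CfgY 𝔸 i)

omit [Fintype (geo9K i).Site] [DecidableEq (geo9K i).Site] in
/-- THE SCALE WEIGHTS CANCEL IN `H′`: `(tG′)·(tG′)·Q′*·(sX⁻¹) = G′G′Q′*X⁻¹` for `t·t·s = 1` (`H′` is unit-free). [cite: Balaban1985RegularSpaces, (1.91) p.91; Balaban1985BackgroundPropagators, (3.25) p.394, bookkeeping] -/
theorem smul_halfword_restrictScalars {t s : ℝ} (hts : t * t * s = 1) :
    (t • (Gp U).restrictScalars ℝ) ∘ₗ (t • (Gp U).restrictScalars ℝ) ∘ₗ (QpsY i parS U).restrictScalars ℝ ∘ₗ (s • (XinvY i parS Gp U).restrictScalars ℝ)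
      = (Gp U ∘ₗ Gp U ∘ₗ QpsY i parS U ∘ₗ XinvY i parS Gp U).restrictScalars ℝ := by
  have hts' : s * t * t = 1 := by rw [show s * t * t = t * t * s by ring]; exact hts
  simp only [LinearMap.smul_comp, LinearMap.comp_smul, smul_smul, hts', one_smul]
  rfl

omit [Fintype (geo9K i).Site] [DecidableEq (geo9K i).Site] in
/-- the half-word in real coordinates. [cite: Balaban1984PropagatorsII, (2.51)–(2.52) p.232, bookkeeping] -/
theorem conjHom_halfword (t s : ℝ) :
    conj b (t • (Gp U).restrictScalars ℝ) ∘ₗ conj b (t • (Gp U).restrictScalars ℝ) ∘ₗ conjHom b ((QpsY i parS U).restrictScalars ℝ) ∘ₗ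
        conj b (s • (XinvY i parS Gp U).restrictScalars ℝ)
      = conjHom b ((t • (Gp U).restrictScalars ℝ) ∘ₗ (t • (Gp U).restrictScalars ℝ) ∘ₗ (QpsY i parS U).restrictScalars ℝ ∘ₗ
          (s • (XinvY i parS Gp U).restrictScalars ℝ)) := by
  simp only [← conjHom_eq_conj, conjHom_comp]

omit [Fintype (geo9K i).Site] [DecidableEq (geo9K i).Site] in
/-- the same with a first factor `E` (an `ℝ`-linear site letter, e.g. `η⁻¹∇_{U,μ}`): `(E·tG′)·(tG′)·Q′*·(sX⁻¹) = E·G′G′Q′*X⁻¹` for `t·t·s = 1`.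
[cite: Balaban1985RegularSpaces, (1.92) p.91; Balaban1985BackgroundPropagators, (3.42) p.397, bookkeeping] -/
theorem smul_gradHalfword_restrictScalars (E : Module.End ℝ (SiteY i → 𝔸)) {t s : ℝ} (hts : t * t * s = 1) :
    (E * (t • (Gp U).restrictScalars ℝ)) ∘ₗ (t • (Gp U).restrictScalars ℝ) ∘ₗ (QpsY i parS U).restrictScalars ℝ ∘ₗ
        (s • (XinvY i parS Gp U).restrictScalars ℝ)
      = E ∘ₗ (Gp U ∘ₗ Gp U ∘ₗ QpsY i parS U ∘ₗ XinvY i parS Gp U).restrictScalars ℝ := by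
  have hts' : s * t * t = 1 := by rw [show s * t * t = t * t * s by ring]; exact hts
  rw [Module.End.mul_eq_comp]
  simp only [LinearMap.smul_comp, LinearMap.comp_smul, smul_smul, LinearMap.comp_assoc, hts', one_smul]
  rfl

omit [Fintype (geo9K i).Site] [DecidableEq (geo9K i).Site] in
/-- the dressed half-word in real coordinates. [cite: Balaban1984PropagatorsII, (2.51)–(2.52) p.232, bookkeeping] -/
theorem conjHom_gradHalfword (E : Module.End ℝ (SiteY i → 𝔸)) (t s : ℝ) :
    (conj b E * conj b (t • (Gp U).restrictScalars ℝ)) ∘ₗ conj b (t • (Gp U).restrictScalars ℝ) ∘ₗ conjHom b ((QpsY i parS U).restrictScalars ℝ) ∘ₗ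
        conj b (s • (XinvY i parS Gp U).restrictScalars ℝ)
      = conjHom b ((E * (t • (Gp U).restrictScalars ℝ)) ∘ₗ (t • (Gp U).restrictScalars ℝ) ∘ₗ (QpsY i parS U).restrictScalars ℝ ∘ₗ
          (s • (XinvY i parS Gp U).restrictScalars ℝ)) := by
  rw [← B9Eq352DivFormLetters.conj_mul]
  simp only [← conjHom_eq_conj, conjHom_comp]

/-- ★★ **THE HALF-WORD `X₁·(tG′)·Q′*·(sX⁻¹)` WITH A GENERIC FIRST FACTOR, TYPED BLOCK CARRIER → SITE CARRIER** (p. 399 «using again Lemma 2.1», twice):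
contractive transporters, a real basis `b` (coordinate bound `M₂`), the geometry ((2.54), `d ≧ 0`, (2.61) at `β`, the scale transfers of `ℓ²` and `ℓ⁻⁴` at
exponent `α` with constant `Λ ≧ 1`), `0 ≦ ρ`, `ρ + 2(α+β)δ₀ ≦ δ`; a first factor `X₁` on the site carrier with majorant `A₁·w(a)·e^{−δd}` (`w ≧ 0`), the
DISPLAYED (3.42)₁ majorant `A·ℓ(a)²·e^{−δd}` of `conj b(tG′)` and the DISPLAYED (3.48)-shape majorant `K·ℓ(a)⁻⁴·e^{−δd}` of `conj b(s·X⁻¹)` ⟹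
`X₁ ∘ conj b(tG′) ∘ conjHom b(Q′*) ∘ conj b(sX⁻¹) ≺ ((M₂Σ‖b_j‖)·A₁·A·K·Λ²·c₁(δ₀,β)²) · (w(a)·ℓ(a)²·ℓ(a)⁻⁴) · e^{−ρd}`.
[cite: Balaban1985BackgroundPropagators, (3.49) p.399, Thm 3.1 (3.42) p.397, Thm 3.2 (3.48) p.398, p.398 (scale transfer), (3.24)–(3.25) p.394; Balaban1984PropagatorsII, (2.52) p.232, Lemma 2.1 (2.61) p.234; Balaban1985RegularSpaces, (1.91) p.91] -/
theorem hasMajorantHom_leftFactor_halfword (hpar : ∀ z w : SiteY i, ‖(parS U z w : 𝔸)‖ ≤ 1 ∧ ‖(((parS U z w)⁻¹ : 𝔸ˣ) : 𝔸)‖ ≤ 1)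
    {M₂ : ℝ} (hM₂ : 0 ≤ M₂) (hrepr : ∀ (v : 𝔸) (j : ι), |b.repr v j| ≤ M₂ * ‖v‖)
    (d₁ : ℕ) {δ₀ δ α βx ρ Λ A₁ A K t s : ℝ} (w : (geo9K i).Site → ℝ) (hw : ∀ a, 0 ≤ w a) (hA₁ : 0 ≤ A₁) (hA : 0 ≤ A) (hK : 0 ≤ K) (hΛ : 1 ≤ Λ)
    (hρ : 0 ≤ ρ) (hα : 0 ≤ α) (hβ : 0 ≤ βx) (hδ₀ : 0 ≤ δ₀) (hr : ρ + 2 * ((α + βx) * δ₀) ≤ δ)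
    (hdnn : ∀ a a' : (geo9K i).Site, 0 ≤ (geo9K i).dist a a') (htri : Triangle254 (toB6 (geo9K i) Rr Hp))
    (h261 : Ineq261 d₁ (toB6 (geo9K i) Rr Hp) δ₀ βx)
    (hT2 : ScaleTransfer (geo9K i) δ₀ α Λ (fun a => (geo9K i).len a ^ 2))
    (hT4 : ScaleTransfer (geo9K i) δ₀ α Λ (fun a => ((geo9K i).len a ^ 4)⁻¹))
    {X₁ : Module.End ℝ (SiteY i × ι → ℝ)}
    (hX : HasMajorant (g := toB6 (geo9K i) Rr Hp) (fun p : SiteY i × ι => ιB (blkOf i.D.toDomains p.1)) X₁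
      (fun a a' => A₁ * w a * Real.exp (-(δ * (geo9K i).dist a a'))))
    (hG : HasMajorant (g := toB6 (geo9K i) Rr Hp) (fun p : SiteY i × ι => ιB (blkOf i.D.toDomains p.1))
      (conj b (t • (Gp U).restrictScalars ℝ)) (fun a a' => A * (geo9K i).len a ^ 2 * Real.exp (-(δ * (geo9K i).dist a a'))))
    (hC : HasMajorant (g := toB6 (geo9K i) Rr Hp) (fun q : BlkY i × ι => ιB q.1)
      (conj b (s • (XinvY i parS Gp U).restrictScalars ℝ)) (fun a a' => K * ((geo9K i).len a ^ 4)⁻¹ * Real.exp (-(δ * (geo9K i).dist a a')))) :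
    HasMajorantHom (g := toB6 (geo9K i) Rr Hp) (fun q : BlkY i × ι => ιB q.1) (fun p : SiteY i × ι => ιB (blkOf i.D.toDomains p.1))
      (X₁ ∘ₗ conj b (t • (Gp U).restrictScalars ℝ) ∘ₗ conjHom b ((QpsY i parS U).restrictScalars ℝ) ∘ₗ conj b (s • (XinvY i parS Gp U).restrictScalars ℝ))
      (fun a a' => ((M₂ * ∑ j, ‖b j‖) * A₁ * A * K * Λ ^ 2 * B6.c1 d₁ δ₀ βx ^ 2) * (w a * (geo9K i).len a ^ 2 * ((geo9K i).len a ^ 4)⁻¹) *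
        Real.exp (-(ρ * (geo9K i).dist a a'))) := by
  set blkS : SiteY i × ι → (geo9K i).Site := fun p => ιB (blkOf i.D.toDomains p.1) with hblkS
  set blkB : BlkY i × ι → (geo9K i).Site := fun q => ιB q.1 with hblkB
  have hc1 : 0 ≤ B6.c1 d₁ δ₀ βx := c1_nonneg d₁ δ₀ βx
  have hΛ0 : 0 ≤ Λ := zero_le_one.trans hΛ
  have hκ : 0 ≤ M₂ * ∑ j, ‖b j‖ := mul_nonneg hM₂ (Finset.sum_nonneg fun j _ => norm_nonneg (b j))
  have hw2 : ∀ a : (geo9K i).Site, 0 ≤ (geo9K i).len a ^ 2 := fun a => sq_nonneg _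
  have hw4 : ∀ a : (geo9K i).Site, 0 ≤ ((geo9K i).len a ^ 4)⁻¹ := fun a => inv_nonneg.mpr (by positivity)
  have hαβ : 0 ≤ (α + βx) * δ₀ := mul_nonneg (add_nonneg hα hβ) hδ₀
  set ρ₁ : ℝ := ρ + (α + βx) * δ₀ with hρ₁
  have hρ₁0 : 0 ≤ ρ₁ := add_nonneg hρ hαβ
  have hρ₁δ : ρ₁ ≤ δ := by rw [hρ₁]; linarith
  have hr₁ : ρ₁ + (α + βx) * δ₀ ≤ δ := by rw [hρ₁]; linarith
  have hr₂ : ρ + (α + βx) * δ₀ ≤ ρ₁ := le_rfl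
  have hρδ : ρ ≤ δ := by linarith
  -- the first two factors: `X₁ ∘ conj(tG′)` at rate `ρ₁` (transfer of `ℓ²`)
  have hXh : HasMajorantHom (g := toB6 (geo9K i) Rr Hp) blkS blkS X₁ (fun a a' => A₁ * w a * Real.exp (-(δ * (geo9K i).dist a a'))) :=
    (hasMajorantHom_iff (g := toB6 (geo9K i) Rr Hp) blkS _ _).mpr hX
  have hGh : HasMajorantHom (g := toB6 (geo9K i) Rr Hp) blkS blkS (conj b (t • (Gp U).restrictScalars ℝ))
      (fun a a' => A * (geo9K i).len a ^ 2 * Real.exp (-(ρ₁ * (geo9K i).dist a a'))) :=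
    hasMajorantHom_rate_mono (R := Rr) (H := Hp) blkS blkS A (fun a => (geo9K i).len a ^ 2) hA hw2 hρ₁δ hdnn
      ((hasMajorantHom_iff (g := toB6 (geo9K i) Rr Hp) blkS _ _).mpr hG)
  have s1 := hasMajorantHom_comp_decay (R := Rr) (H := Hp) blkS blkS blkS d₁ δ₀ α βx ρ₁ δ Λ A₁ A w (fun a => (geo9K i).len a ^ 2)
    hw hw2 hΛ0 hA₁ hA hρ₁0 hr₁ hdnn htri hT2 h261 hXh hGh
  -- the last two factors: `conjHom(Q′*) ∘ conj(sX⁻¹)`, block-local after the (3.48) block, at rate `ρ`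
  have hCh : HasMajorantHom (g := toB6 (geo9K i) Rr Hp) blkB blkB (conj b (s • (XinvY i parS Gp U).restrictScalars ℝ))
      (fun a a' => K * ((geo9K i).len a ^ 4)⁻¹ * Real.exp (-(ρ * (geo9K i).dist a a'))) :=
    hasMajorantHom_rate_mono (R := Rr) (H := Hp) blkB blkB K (fun a => ((geo9K i).len a ^ 4)⁻¹) hK hw4 hρδ hdnn
      ((hasMajorantHom_iff (g := toB6 (geo9K i) Rr Hp) blkB _ _).mpr hC)
  have hKC : ∀ a a' : (geo9K i).Site, 0 ≤ K * ((geo9K i).len a ^ 4)⁻¹ * Real.exp (-(ρ * (geo9K i).dist a a')) := fun a a' =>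
    mul_nonneg (mul_nonneg hK (hw4 a)) (Real.exp_nonneg _)
  have s2 : HasMajorantHom (g := toB6 (geo9K i) Rr Hp) blkB blkS
      (conjHom b ((QpsY i parS U).restrictScalars ℝ) ∘ₗ conj b (s • (XinvY i parS Gp U).restrictScalars ℝ))
      (fun a a' => ((M₂ * ∑ j, ‖b j‖) * K) * ((geo9K i).len a ^ 4)⁻¹ * Real.exp (-(ρ * (geo9K i).dist a a'))) :=
    hasMajorantHom_mono (g := toB6 (geo9K i) Rr Hp) blkB blkS
      (hasMajorantHom_local_comp (R := Rr) (H := Hp) blkB blkB blkS (M₂ * ∑ j, ‖b j‖) hKC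
        (hasMajorantHom_conjHom_QpsY i b ιB parS U hpar hM₂ hrepr) hCh) fun a a' => le_of_eq (by ring)
  -- compose (transfer of `ℓ⁻⁴`)
  have s3 := hasMajorantHom_comp_decay (R := Rr) (H := Hp) blkB blkS blkS d₁ δ₀ α βx ρ ρ₁ Λ (A₁ * A * Λ * B6.c1 d₁ δ₀ βx)
    ((M₂ * ∑ j, ‖b j‖) * K) (fun a => w a * (geo9K i).len a ^ 2) (fun a => ((geo9K i).len a ^ 4)⁻¹)
    (fun a => mul_nonneg (hw a) (hw2 a)) hw4 hΛ0 (by positivity) (mul_nonneg hκ hK) hρ hr₂ hdnn htri hT4 h261 s1 s2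
  have hassoc : (X₁ ∘ₗ conj b (t • (Gp U).restrictScalars ℝ)) ∘ₗ
      (conjHom b ((QpsY i parS U).restrictScalars ℝ) ∘ₗ conj b (s • (XinvY i parS Gp U).restrictScalars ℝ))
      = X₁ ∘ₗ conj b (t • (Gp U).restrictScalars ℝ) ∘ₗ conjHom b ((QpsY i parS U).restrictScalars ℝ) ∘ₗ
          conj b (s • (XinvY i parS Gp U).restrictScalars ℝ) := by
    simp only [LinearMap.comp_assoc]
  rw [hassoc] at s3
  exact hasMajorantHom_mono (g := toB6 (geo9K i) Rr Hp) blkB blkS s3 fun a a' => le_of_eq (by ring)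

/-- ★★ **THE TWO-SPACE MAJORANT OF `H′ = G′²Q′*(Q′G′²Q′*)⁻¹` AT GENERIC LETTERS** ([B8] (1.91)–(1.92) via [B9] Thms 3.1–3.2 «using again Lemma 2.1»): under the
hypotheses of `hasMajorantHom_leftFactor_halfword` with first factor `conj b(tG′)` itself and `t·t·s = 1`:
`conjHom b(G′G′Q′*X⁻¹) ≺ ((M₂Σ‖b_j‖)·A·A·K·Λ²·c₁(δ₀,β)²) · e^{−ρd}` from the block carrier to the site carrier — LEVEL-FREE (`ℓ²·ℓ²·ℓ⁻⁴ = 1`).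
[cite: Balaban1985RegularSpaces, (1.91)–(1.92) p.91; Balaban1985BackgroundPropagators, Thm 3.1 (3.42) p.397, Thm 3.2 (3.48) p.398, (3.49) p.399; Balaban1984PropagatorsII, (2.52) p.232, (2.61) p.234] -/
theorem hasMajorantHom_conj_Hprime (hpar : ∀ z w : SiteY i, ‖(parS U z w : 𝔸)‖ ≤ 1 ∧ ‖(((parS U z w)⁻¹ : 𝔸ˣ) : 𝔸)‖ ≤ 1)
    {M₂ : ℝ} (hM₂ : 0 ≤ M₂) (hrepr : ∀ (v : 𝔸) (j : ι), |b.repr v j| ≤ M₂ * ‖v‖)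
    (d₁ : ℕ) {δ₀ δ α βx ρ Λ A K t s : ℝ} (hA : 0 ≤ A) (hK : 0 ≤ K) (hΛ : 1 ≤ Λ)
    (hρ : 0 ≤ ρ) (hα : 0 ≤ α) (hβ : 0 ≤ βx) (hδ₀ : 0 ≤ δ₀) (hr : ρ + 2 * ((α + βx) * δ₀) ≤ δ) (hts : t * t * s = 1)
    (hdnn : ∀ a a' : (geo9K i).Site, 0 ≤ (geo9K i).dist a a') (htri : Triangle254 (toB6 (geo9K i) Rr Hp))
    (h261 : Ineq261 d₁ (toB6 (geo9K i) Rr Hp) δ₀ βx)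
    (hT2 : ScaleTransfer (geo9K i) δ₀ α Λ (fun a => (geo9K i).len a ^ 2))
    (hT4 : ScaleTransfer (geo9K i) δ₀ α Λ (fun a => ((geo9K i).len a ^ 4)⁻¹))
    (hG : HasMajorant (g := toB6 (geo9K i) Rr Hp) (fun p : SiteY i × ι => ιB (blkOf i.D.toDomains p.1))
      (conj b (t • (Gp U).restrictScalars ℝ)) (fun a a' => A * (geo9K i).len a ^ 2 * Real.exp (-(δ * (geo9K i).dist a a'))))
    (hC : HasMajorant (g := toB6 (geo9K i) Rr Hp) (fun q : BlkY i × ι => ιB q.1)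
      (conj b (s • (XinvY i parS Gp U).restrictScalars ℝ)) (fun a a' => K * ((geo9K i).len a ^ 4)⁻¹ * Real.exp (-(δ * (geo9K i).dist a a')))) :
    HasMajorantHom (g := toB6 (geo9K i) Rr Hp) (fun q : BlkY i × ι => ιB q.1) (fun p : SiteY i × ι => ιB (blkOf i.D.toDomains p.1))
      (conjHom b ((Gp U ∘ₗ Gp U ∘ₗ QpsY i parS U ∘ₗ XinvY i parS Gp U).restrictScalars ℝ))
      (fun a a' => ((M₂ * ∑ j, ‖b j‖) * A * A * K * Λ ^ 2 * B6.c1 d₁ δ₀ βx ^ 2) * Real.exp (-(ρ * (geo9K i).dist a a'))) := by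
  have hlen : ∀ a : (geo9K i).Site, 0 < (geo9K i).len a := fun a => by rw [geo9K_len_kGeo]; exact len_pos i a
  have h := hasMajorantHom_leftFactor_halfword i b ιB parS Gp U hpar hM₂ hrepr d₁ (fun a => (geo9K i).len a ^ 2) (fun a => sq_nonneg _) hA hA hK hΛ
    hρ hα hβ hδ₀ hr hdnn htri h261 hT2 hT4 hG hG hC
  rw [conjHom_halfword, smul_halfword_restrictScalars i parS Gp U hts] at h
  refine hasMajorantHom_mono (g := toB6 (geo9K i) Rr Hp) _ _ h fun a a' => le_of_eq ?_
  have ha : (geo9K i).len a ≠ 0 := (hlen a).ne'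
  field_simp

/-- ★★ **THE TWO-SPACE MAJORANT OF THE DRESSED `E·H′` (e.g. `E = η⁻¹∇_{U,μ}`) AT GENERIC LETTERS** ((1.92)'s gradient line via (3.42)₂): under the same hypotheses
with the DISPLAYED (3.42)₂-type majorant `A₁·ℓ(a)·e^{−δd}` of the left entry `conj b(E)·conj b(tG′)` (junction file 16's output shape):
`conjHom b(E ∘ G′G′Q′*X⁻¹) ≺ ((M₂Σ‖b_j‖)·A₁·A·K·Λ²·c₁(δ₀,β)²) · ℓ(a)⁻¹ · e^{−ρd}` (`ℓ·ℓ²·ℓ⁻⁴ = ℓ⁻¹`).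
[cite: Balaban1985RegularSpaces, (1.92) p.91; Balaban1985BackgroundPropagators, Thm 3.1 (3.42) p.397, Thm 3.2 (3.48) p.398, (3.49) p.399; Balaban1984PropagatorsII, (2.52) p.232, (2.61) p.234] -/
theorem hasMajorantHom_conj_gradHprime (hpar : ∀ z w : SiteY i, ‖(parS U z w : 𝔸)‖ ≤ 1 ∧ ‖(((parS U z w)⁻¹ : 𝔸ˣ) : 𝔸)‖ ≤ 1)
    {M₂ : ℝ} (hM₂ : 0 ≤ M₂) (hrepr : ∀ (v : 𝔸) (j : ι), |b.repr v j| ≤ M₂ * ‖v‖)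
    (d₁ : ℕ) {δ₀ δ α βx ρ Λ A₁ A K t s : ℝ} (hA₁ : 0 ≤ A₁) (hA : 0 ≤ A) (hK : 0 ≤ K) (hΛ : 1 ≤ Λ)
    (hρ : 0 ≤ ρ) (hα : 0 ≤ α) (hβ : 0 ≤ βx) (hδ₀ : 0 ≤ δ₀) (hr : ρ + 2 * ((α + βx) * δ₀) ≤ δ) (hts : t * t * s = 1)
    (hdnn : ∀ a a' : (geo9K i).Site, 0 ≤ (geo9K i).dist a a') (htri : Triangle254 (toB6 (geo9K i) Rr Hp))
    (h261 : Ineq261 d₁ (toB6 (geo9K i) Rr Hp) δ₀ βx)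
    (hT2 : ScaleTransfer (geo9K i) δ₀ α Λ (fun a => (geo9K i).len a ^ 2))
    (hT4 : ScaleTransfer (geo9K i) δ₀ α Λ (fun a => ((geo9K i).len a ^ 4)⁻¹))
    (E : Module.End ℝ (SiteY i → 𝔸))
    (hEG : HasMajorant (g := toB6 (geo9K i) Rr Hp) (fun p : SiteY i × ι => ιB (blkOf i.D.toDomains p.1))
      (conj b E * conj b (t • (Gp U).restrictScalars ℝ)) (fun a a' => A₁ * (geo9K i).len a * Real.exp (-(δ * (geo9K i).dist a a'))))
    (hG : HasMajorant (g := toB6 (geo9K i) Rr Hp) (fun p : SiteY i × ι => ιB (blkOf i.D.toDomains p.1))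
      (conj b (t • (Gp U).restrictScalars ℝ)) (fun a a' => A * (geo9K i).len a ^ 2 * Real.exp (-(δ * (geo9K i).dist a a'))))
    (hC : HasMajorant (g := toB6 (geo9K i) Rr Hp) (fun q : BlkY i × ι => ιB q.1)
      (conj b (s • (XinvY i parS Gp U).restrictScalars ℝ)) (fun a a' => K * ((geo9K i).len a ^ 4)⁻¹ * Real.exp (-(δ * (geo9K i).dist a a')))) :
    HasMajorantHom (g := toB6 (geo9K i) Rr Hp) (fun q : BlkY i × ι => ιB q.1) (fun p : SiteY i × ι => ιB (blkOf i.D.toDomains p.1))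
      (conjHom b (E ∘ₗ (Gp U ∘ₗ Gp U ∘ₗ QpsY i parS U ∘ₗ XinvY i parS Gp U).restrictScalars ℝ))
      (fun a a' => ((M₂ * ∑ j, ‖b j‖) * A₁ * A * K * Λ ^ 2 * B6.c1 d₁ δ₀ βx ^ 2) * ((geo9K i).len a)⁻¹ * Real.exp (-(ρ * (geo9K i).dist a a'))) := by
  have hlen : ∀ a : (geo9K i).Site, 0 < (geo9K i).len a := fun a => by rw [geo9K_len_kGeo]; exact len_pos i a
  have h := hasMajorantHom_leftFactor_halfword i b ιB parS Gp U hpar hM₂ hrepr d₁ (fun a => (geo9K i).len a) (fun a => (hlen a).le) hA₁ hA hK hΛ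
    hρ hα hβ hδ₀ hr hdnn htri h261 hT2 hT4 hEG hG hC
  rw [conjHom_gradHalfword, smul_gradHalfword_restrictScalars i parS Gp U E hts] at h
  refine hasMajorantHom_mono (g := toB6 (geo9K i) Rr Hp) _ _ h fun a a' => le_of_eq ?_
  have ha : (geo9K i).len a ≠ 0 := (hlen a).ne'
  field_simp

end Generic

/-! ## §3 At the knit letter: (E6) and (E7) -/

section Knit

variable {N : ℕ} {G : Subgroup (Matrix (Fin N) (Fin N) ℂ)ˣ}
variable {ι : Type} [Fintype ι] (b : Module.Basis ι ℝ (Matrix (Fin N) (Fin N) ℂ))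
variable [Fintype (geo9K i).Site] [DecidableEq (geo9K i).Site] {Rr : ℝ} {Hp : Prop} (ιB : BlkY i → IBondY i)

/-- ★★ **THE TWO-SPACE MAJORANT OF `H′(U) = G′²Q′*(Q′G′²Q′*)⁻¹(U)` AT THE KNIT LETTER**: for `G ≤ U(N)` (`N ≥ 1`), `G`-valued knit legs, a real basis `b`, the
geometry, `ρ + 2(α+β)δ₀ ≦ δ`, `η²·η²·s = 1` (`η = etaS i`), the DISPLAYED (3.42)₁ majorant `A·ℓ²·e^{−δd}` of `conj b(η²G′(U; parKnitY))` and the DISPLAYED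
(3.48)-shape majorant `K·ℓ⁻⁴·e^{−δd}` of `conj b(s·(Q′G′²Q′*)⁻¹(U; parKnitY))`: `conjHom b(H′(U)) ≺ (M₂Σ‖b_j‖)·A²KΛ²c₁² · e^{−ρd}`.
[cite: Balaban1985RegularSpaces, (1.91)–(1.92) p.91; Balaban1985BackgroundPropagators, Thm 3.1 (3.42) p.397, Thm 3.2 (3.48) p.398, (3.49) p.399, (3.25) p.394] -/
theorem hasMajorantHom_conj_Hprime_parKnitY [Nonempty (Fin N)] (hG : G ≤ B7Prop2Explicit.unitaryUnits (Matrix (Fin N) (Fin N) ℂ))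
    {U : CfgY (Matrix (Fin N) (Fin N) ℂ) i} (hpar : ∀ z w : SiteY i, parKnitY i U z w ∈ G)
    {M₂ : ℝ} (hM₂ : 0 ≤ M₂) (hrepr : ∀ (v : Matrix (Fin N) (Fin N) ℂ) (j : ι), |b.repr v j| ≤ M₂ * ‖v‖)
    (d₁ : ℕ) {δ₀ δ α βx ρ Λ A K s : ℝ} (hA : 0 ≤ A) (hK : 0 ≤ K) (hΛ : 1 ≤ Λ)
    (hρ : 0 ≤ ρ) (hα : 0 ≤ α) (hβ : 0 ≤ βx) (hδ₀ : 0 ≤ δ₀) (hr : ρ + 2 * ((α + βx) * δ₀) ≤ δ) (hs : (etaS i ^ 2 * etaS i ^ 2) * s = 1)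
    (hdnn : ∀ a a' : (geo9K i).Site, 0 ≤ (geo9K i).dist a a') (htri : Triangle254 (toB6 (geo9K i) Rr Hp))
    (h261 : Ineq261 d₁ (toB6 (geo9K i) Rr Hp) δ₀ βx)
    (hT2 : ScaleTransfer (geo9K i) δ₀ α Λ (fun a => (geo9K i).len a ^ 2))
    (hT4 : ScaleTransfer (geo9K i) δ₀ α Λ (fun a => ((geo9K i).len a ^ 4)⁻¹))
    (hGm : HasMajorant (g := toB6 (geo9K i) Rr Hp) (fun p : SiteY i × ι => ιB (blkOf i.D.toDomains p.1))
      (conj b ((etaS i ^ 2) • (GpY i (parKnitY i) U).restrictScalars ℝ)) (fun a a' => A * (geo9K i).len a ^ 2 * Real.exp (-(δ * (geo9K i).dist a a'))))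
    (hC : HasMajorant (g := toB6 (geo9K i) Rr Hp) (fun q : BlkY i × ι => ιB q.1)
      (conj b (s • (XinvY i (parKnitY i) (GpY i (parKnitY i)) U).restrictScalars ℝ))
      (fun a a' => K * ((geo9K i).len a ^ 4)⁻¹ * Real.exp (-(δ * (geo9K i).dist a a')))) :
    HasMajorantHom (g := toB6 (geo9K i) Rr Hp) (fun q : BlkY i × ι => ιB q.1) (fun p : SiteY i × ι => ιB (blkOf i.D.toDomains p.1))
      (conjHom b ((GpY i (parKnitY i) U ∘ₗ GpY i (parKnitY i) U ∘ₗ QpsY i (parKnitY i) U ∘ₗ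
        XinvY i (parKnitY i) (GpY i (parKnitY i)) U).restrictScalars ℝ))
      (fun a a' => ((M₂ * ∑ j, ‖b j‖) * A * A * K * Λ ^ 2 * B6.c1 d₁ δ₀ βx ^ 2) * Real.exp (-(ρ * (geo9K i).dist a a'))) :=
  hasMajorantHom_conj_Hprime i b ιB (parKnitY i) (GpY i (parKnitY i)) U (parKnitY_contractive i hG hpar) hM₂ hrepr d₁ hA hK hΛ hρ hα hβ hδ₀ hr
    hs hdnn htri h261 hT2 hT4 hGm hC

/-- ★★★ **(E6) `hp_sup` AT THE KNIT LETTER** ([B8] (1.92) `|H′X| ≦ B₀|X|`): under the hypotheses of `hasMajorantHom_conj_Hprime_parKnitY` and the row sum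
`Σ_{a′}e^{−ρd(a,a′)} ≦ c`: `‖Y(s)‖ ≦ M ∀s ⇒ ‖(G′(G′(Q′*((Q′G′²Q′*)⁻¹Y))))(z)‖ ≦ (Σ‖b_j‖)·((M₂Σ‖b_j‖)A²KΛ²c₁²)·c·M₂·M` at every site `z` — `B₀′_H` free of the
member, `n`, `k`, `N`, `η` (the scale transfers are displayed; on a constant-level member they are free, `knit_E6_constLev`).
[cite: Balaban1985RegularSpaces, (1.91)–(1.92) p.91, p.92 («B₀ is an absolute constant»); Balaban1985BackgroundPropagators, Thm 3.1 (3.42) p.397, Thm 3.2 (3.48) p.398, (3.49) p.399; Balaban1984PropagatorsII, (2.52) p.232, (2.61) p.234] -/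
theorem knit_E6 [Nonempty (Fin N)] (hG : G ≤ B7Prop2Explicit.unitaryUnits (Matrix (Fin N) (Fin N) ℂ))
    {U : CfgY (Matrix (Fin N) (Fin N) ℂ) i} (hpar : ∀ z w : SiteY i, parKnitY i U z w ∈ G)
    {M₂ : ℝ} (hM₂ : 0 ≤ M₂) (hrepr : ∀ (v : Matrix (Fin N) (Fin N) ℂ) (j : ι), |b.repr v j| ≤ M₂ * ‖v‖)
    (d₁ : ℕ) {δ₀ δ α βx ρ Λ A K s c : ℝ} (hA : 0 ≤ A) (hK : 0 ≤ K) (hΛ : 1 ≤ Λ)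
    (hρ : 0 ≤ ρ) (hα : 0 ≤ α) (hβ : 0 ≤ βx) (hδ₀ : 0 ≤ δ₀) (hr : ρ + 2 * ((α + βx) * δ₀) ≤ δ) (hs : (etaS i ^ 2 * etaS i ^ 2) * s = 1)
    (hdnn : ∀ a a' : (geo9K i).Site, 0 ≤ (geo9K i).dist a a') (htri : Triangle254 (toB6 (geo9K i) Rr Hp))
    (h261 : Ineq261 d₁ (toB6 (geo9K i) Rr Hp) δ₀ βx)
    (hT2 : ScaleTransfer (geo9K i) δ₀ α Λ (fun a => (geo9K i).len a ^ 2))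
    (hT4 : ScaleTransfer (geo9K i) δ₀ α Λ (fun a => ((geo9K i).len a ^ 4)⁻¹))
    (hGm : HasMajorant (g := toB6 (geo9K i) Rr Hp) (fun p : SiteY i × ι => ιB (blkOf i.D.toDomains p.1))
      (conj b ((etaS i ^ 2) • (GpY i (parKnitY i) U).restrictScalars ℝ)) (fun a a' => A * (geo9K i).len a ^ 2 * Real.exp (-(δ * (geo9K i).dist a a'))))
    (hC : HasMajorant (g := toB6 (geo9K i) Rr Hp) (fun q : BlkY i × ι => ιB q.1)
      (conj b (s • (XinvY i (parKnitY i) (GpY i (parKnitY i)) U).restrictScalars ℝ))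
      (fun a a' => K * ((geo9K i).len a ^ 4)⁻¹ * Real.exp (-(δ * (geo9K i).dist a a'))))
    (hrow : ∀ a : (geo9K i).Site, ∑ a' : (geo9K i).Site, Real.exp (-(ρ * (geo9K i).dist a a')) ≤ c)
    (Y : BlkY i → Matrix (Fin N) (Fin N) ℂ) {M : ℝ} (hY : ∀ s, ‖Y s‖ ≤ M) (z : SiteY i) :
    ‖GpY i (parKnitY i) U (GpY i (parKnitY i) U (QpsY i (parKnitY i) U (XinvY i (parKnitY i) (GpY i (parKnitY i)) U Y))) z‖
      ≤ (∑ j, ‖b j‖) * (((M₂ * ∑ j, ‖b j‖) * A * A * K * Λ ^ 2 * B6.c1 d₁ δ₀ βx ^ 2) * c * (M₂ * M)) := by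
  have hH := hasMajorantHom_conj_Hprime_parKnitY i b ιB hG hpar hM₂ hrepr d₁ hA hK hΛ hρ hα hβ hδ₀ hr hs hdnn htri h261 hT2 hT4 hGm hC
  have hκ : 0 ≤ (M₂ * ∑ j, ‖b j‖) * A * A * K * Λ ^ 2 * B6.c1 d₁ δ₀ βx ^ 2 := by
    have := c1_nonneg d₁ δ₀ βx
    have : 0 ≤ ∑ j, ‖b j‖ := Finset.sum_nonneg fun _ _ => norm_nonneg _
    positivity
  have hH' : HasMajorantHom (g := toB6 (geo9K i) Rr Hp) (fun q : BlkY i × ι => ιB q.1) (fun p : SiteY i × ι => ιB (blkOf i.D.toDomains p.1))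
      (conjHom b ((GpY i (parKnitY i) U ∘ₗ GpY i (parKnitY i) U ∘ₗ QpsY i (parKnitY i) U ∘ₗ
        XinvY i (parKnitY i) (GpY i (parKnitY i)) U).restrictScalars ℝ))
      (fun a a' => ((M₂ * ∑ j, ‖b j‖) * A * A * K * Λ ^ 2 * B6.c1 d₁ δ₀ βx ^ 2) * (fun _ : (geo9K i).Site => (1 : ℝ)) a *
        Real.exp (-(ρ * (geo9K i).dist a a'))) :=
    hasMajorantHom_mono (g := toB6 (geo9K i) Rr Hp) _ _ hH fun a a' => le_of_eq (by rw [mul_one])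
  have h := norm_hom_apply_le_of_hasMajorantHom_exp i b ιB _ hκ (fun _ => zero_le_one) hH' hrow hM₂ hrepr Y hY z
  rw [mul_one] at h
  exact h

/-- (E6) on a CONSTANT-LEVEL member: the scale transfers discharged (`α = 0`, `Λ = 1`), `ρ + 2βδ₀ ≦ δ`.
[cite: Balaban1985RegularSpaces, (1.92) p.91, p.77 («Ω_j = T_η»); Balaban1985BackgroundPropagators, Thm 3.1 (3.42) p.397, Thm 3.2 (3.48) p.398, (3.49) p.399] -/
theorem knit_E6_constLev [Nonempty (Fin N)] {n : ℕ} (hlev : ∀ z : SiteY i, levY i z = n)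
    (hG : G ≤ B7Prop2Explicit.unitaryUnits (Matrix (Fin N) (Fin N) ℂ))
    {U : CfgY (Matrix (Fin N) (Fin N) ℂ) i} (hpar : ∀ z w : SiteY i, parKnitY i U z w ∈ G)
    {M₂ : ℝ} (hM₂ : 0 ≤ M₂) (hrepr : ∀ (v : Matrix (Fin N) (Fin N) ℂ) (j : ι), |b.repr v j| ≤ M₂ * ‖v‖)
    (d₁ : ℕ) {δ₀ δ βx ρ A K s c : ℝ} (hA : 0 ≤ A) (hK : 0 ≤ K) (hρ : 0 ≤ ρ) (hβ : 0 ≤ βx) (hδ₀ : 0 ≤ δ₀) (hr : ρ + 2 * (βx * δ₀) ≤ δ)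
    (hs : (etaS i ^ 2 * etaS i ^ 2) * s = 1)
    (hdnn : ∀ a a' : (geo9K i).Site, 0 ≤ (geo9K i).dist a a') (htri : Triangle254 (toB6 (geo9K i) Rr Hp))
    (h261 : Ineq261 d₁ (toB6 (geo9K i) Rr Hp) δ₀ βx)
    (hGm : HasMajorant (g := toB6 (geo9K i) Rr Hp) (fun p : SiteY i × ι => ιB (blkOf i.D.toDomains p.1))
      (conj b ((etaS i ^ 2) • (GpY i (parKnitY i) U).restrictScalars ℝ)) (fun a a' => A * (geo9K i).len a ^ 2 * Real.exp (-(δ * (geo9K i).dist a a'))))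
    (hC : HasMajorant (g := toB6 (geo9K i) Rr Hp) (fun q : BlkY i × ι => ιB q.1)
      (conj b (s • (XinvY i (parKnitY i) (GpY i (parKnitY i)) U).restrictScalars ℝ))
      (fun a a' => K * ((geo9K i).len a ^ 4)⁻¹ * Real.exp (-(δ * (geo9K i).dist a a'))))
    (hrow : ∀ a : (geo9K i).Site, ∑ a' : (geo9K i).Site, Real.exp (-(ρ * (geo9K i).dist a a')) ≤ c)
    (Y : BlkY i → Matrix (Fin N) (Fin N) ℂ) {M : ℝ} (hY : ∀ s, ‖Y s‖ ≤ M) (z : SiteY i) :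
    ‖GpY i (parKnitY i) U (GpY i (parKnitY i) U (QpsY i (parKnitY i) U (XinvY i (parKnitY i) (GpY i (parKnitY i)) U Y))) z‖
      ≤ (∑ j, ‖b j‖) * (((M₂ * ∑ j, ‖b j‖) * A * A * K * B6.c1 d₁ δ₀ βx ^ 2) * c * (M₂ * M)) := by
  have hr' : ρ + 2 * ((0 + βx) * δ₀) ≤ δ := by rw [zero_add]; exact hr
  have h := knit_E6 i b ιB hG hpar hM₂ hrepr d₁ hA hK le_rfl hρ le_rfl hβ hδ₀ hr' hs hdnn htri h261
    (scaleTransfer_of_constLev i hlev δ₀ fun x => x ^ 2) (scaleTransfer_of_constLev i hlev δ₀ fun x => (x ^ 4)⁻¹) hGm hC hrow Y hY z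
  rw [one_pow, mul_one] at h
  exact h

/-- ★★ **THE TWO-SPACE MAJORANT OF `η⁻¹∇_{U,μ}H′(U)` AT THE KNIT LETTER** from the DISPLAYED (3.42)₂-type left entry
`conj b(η⁻¹∇_{U,μ})·conj b(η²G′(U; parKnitY)) ≺ A₁·ℓ·e^{−δd}` (junction file 16's output shape), the (3.42)₁ majorant and the (3.48)-shape majorant:
`conjHom b(η⁻¹∇_{U,μ} ∘ H′(U)) ≺ (M₂Σ‖b_j‖)·A₁AKΛ²c₁² · ℓ⁻¹ · e^{−ρd}`.
[cite: Balaban1985RegularSpaces, (1.92) p.91; Balaban1985BackgroundPropagators, Thm 3.1 (3.42)₂ p.397, (3.3) p.390, Thm 3.2 (3.48) p.398, (3.49) p.399] -/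
theorem hasMajorantHom_conj_gradHprime_parKnitY [Nonempty (Fin N)] (hG : G ≤ B7Prop2Explicit.unitaryUnits (Matrix (Fin N) (Fin N) ℂ))
    {U : CfgY (Matrix (Fin N) (Fin N) ℂ) i} (hpar : ∀ z w : SiteY i, parKnitY i U z w ∈ G)
    {M₂ : ℝ} (hM₂ : 0 ≤ M₂) (hrepr : ∀ (v : Matrix (Fin N) (Fin N) ℂ) (j : ι), |b.repr v j| ≤ M₂ * ‖v‖)
    (d₁ : ℕ) {δ₀ δ α βx ρ Λ A₁ A K s : ℝ} (hA₁ : 0 ≤ A₁) (hA : 0 ≤ A) (hK : 0 ≤ K) (hΛ : 1 ≤ Λ)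
    (hρ : 0 ≤ ρ) (hα : 0 ≤ α) (hβ : 0 ≤ βx) (hδ₀ : 0 ≤ δ₀) (hr : ρ + 2 * ((α + βx) * δ₀) ≤ δ) (hs : (etaS i ^ 2 * etaS i ^ 2) * s = 1)
    (hdnn : ∀ a a' : (geo9K i).Site, 0 ≤ (geo9K i).dist a a') (htri : Triangle254 (toB6 (geo9K i) Rr Hp))
    (h261 : Ineq261 d₁ (toB6 (geo9K i) Rr Hp) δ₀ βx)
    (hT2 : ScaleTransfer (geo9K i) δ₀ α Λ (fun a => (geo9K i).len a ^ 2))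
    (hT4 : ScaleTransfer (geo9K i) δ₀ α Λ (fun a => ((geo9K i).len a ^ 4)⁻¹))
    (μ : Fin (d + 1))
    (hDG : HasMajorant (g := toB6 (geo9K i) Rr Hp) (fun p : SiteY i × ι => ιB (blkOf i.D.toDomains p.1))
      (conj b (diffLetter (shiftY i) (UboxY i U) ((((etaS i : ℝ) : ℂ))⁻¹) (Sum.inl μ)) * conj b ((etaS i ^ 2) • (GpY i (parKnitY i) U).restrictScalars ℝ))
      (fun a a' => A₁ * (geo9K i).len a * Real.exp (-(δ * (geo9K i).dist a a'))))
    (hGm : HasMajorant (g := toB6 (geo9K i) Rr Hp) (fun p : SiteY i × ι => ιB (blkOf i.D.toDomains p.1))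
      (conj b ((etaS i ^ 2) • (GpY i (parKnitY i) U).restrictScalars ℝ)) (fun a a' => A * (geo9K i).len a ^ 2 * Real.exp (-(δ * (geo9K i).dist a a'))))
    (hC : HasMajorant (g := toB6 (geo9K i) Rr Hp) (fun q : BlkY i × ι => ιB q.1)
      (conj b (s • (XinvY i (parKnitY i) (GpY i (parKnitY i)) U).restrictScalars ℝ))
      (fun a a' => K * ((geo9K i).len a ^ 4)⁻¹ * Real.exp (-(δ * (geo9K i).dist a a')))) :
    HasMajorantHom (g := toB6 (geo9K i) Rr Hp) (fun q : BlkY i × ι => ιB q.1) (fun p : SiteY i × ι => ιB (blkOf i.D.toDomains p.1))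
      (conjHom b (gradLetterF (shiftY i) (UboxY i U) ((((etaS i : ℝ) : ℂ))⁻¹) μ ∘ₗ
        (GpY i (parKnitY i) U ∘ₗ GpY i (parKnitY i) U ∘ₗ QpsY i (parKnitY i) U ∘ₗ XinvY i (parKnitY i) (GpY i (parKnitY i)) U).restrictScalars ℝ))
      (fun a a' => ((M₂ * ∑ j, ‖b j‖) * A₁ * A * K * Λ ^ 2 * B6.c1 d₁ δ₀ βx ^ 2) * ((geo9K i).len a)⁻¹ * Real.exp (-(ρ * (geo9K i).dist a a'))) := by
  rw [diffLetter_inl] at hDG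
  exact hasMajorantHom_conj_gradHprime i b ιB (parKnitY i) (GpY i (parKnitY i)) U (parKnitY_contractive i hG hpar) hM₂ hrepr d₁ hA₁ hA hK hΛ hρ hα hβ
    hδ₀ hr hs hdnn htri h261 hT2 hT4 _ hDG hGm hC

omit [Fintype ι] [Fintype (geo9K i).Site] [DecidableEq (geo9K i).Site] in
/-- arithmetic of the gradient line: `η⁻¹x ≦ S·(κ(Lη)⁻¹c·m) ⇒ L·x ≦ S·(κc·m)` (`L, η > 0`). [cite: Balaban1985RegularSpaces, (1.92) p.91, bookkeeping] -/
theorem scale_aux {L η x S κ c m : ℝ} (hL : 0 < L) (hη : 0 < η) (h : η⁻¹ * x ≤ S * (κ * (L * η)⁻¹ * c * m)) : L * x ≤ S * (κ * c * m) := by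
  have hLη : 0 < L * η := mul_pos hL hη
  have h' := mul_le_mul_of_nonneg_left h hLη.le
  have e1 : L * η * (η⁻¹ * x) = L * x := by field_simp
  have e2 : L * η * (S * (κ * (L * η)⁻¹ * c * m)) = S * (κ * c * m) := by field_simp
  rw [e1, e2] at h'
  exact h'

/-- ★★★ **(E7) `hp_grad` AT THE KNIT LETTER, CONSTANT-LEVEL MEMBER** ([B8] (1.92) `(Lʲη)|∇^η_{U₀}H′X| ≦ B₀|X|`, `j ≦ n`): for `G ≤ U(N)` (`N ≥ 1`), `G`-valued knit
legs, print's units `c_f = L^k`, the geometry ((2.54), `d ≧ 0`, (2.61) at `β`), `ρ + 2βδ₀ ≦ δ`, `η²·η²·s = 1`, the three DISPLAYED majorants and the row sum at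
`ρ`: `‖Y(s)‖ ≦ M ∀s ⇒ Lʲ·‖(∇_{U,μ}H′Y)(z)‖ ≦ (Σ‖b_j‖)·((M₂Σ‖b_j‖)A₁AKc₁²)·c·M₂·M` for every `j ≦ n` — equivalently, with the consumer's `η′ > 0`,
`(Lʲη′)·η′⁻¹·‖(∇_{U,μ}H′Y)(z)‖ ≦ …` (`knit_E7_constLev'`).
[cite: Balaban1985RegularSpaces, (1.92) p.91, (1.1) p.76, p.77 («Ω_j = T_η»); Balaban1985BackgroundPropagators, Thm 3.1 (3.42)₂ p.397, (3.3) p.390, Thm 3.2 (3.48) p.398, (3.49) p.399; Balaban1984PropagatorsII, (2.61) p.234] -/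
theorem knit_E7_constLev [Nonempty (Fin N)] {n : ℕ} (hlev : ∀ z : SiteY i, levY i z = n) (hcf : i.cf = (((ℓ + 1 : ℕ) : ℝ)) ^ i.k)
    (hG : G ≤ B7Prop2Explicit.unitaryUnits (Matrix (Fin N) (Fin N) ℂ))
    {U : CfgY (Matrix (Fin N) (Fin N) ℂ) i} (hpar : ∀ z w : SiteY i, parKnitY i U z w ∈ G)
    {M₂ : ℝ} (hM₂ : 0 ≤ M₂) (hrepr : ∀ (v : Matrix (Fin N) (Fin N) ℂ) (j : ι), |b.repr v j| ≤ M₂ * ‖v‖)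
    (d₁ : ℕ) {δ₀ δ βx ρ A₁ A K s c : ℝ} (hA₁ : 0 ≤ A₁) (hA : 0 ≤ A) (hK : 0 ≤ K) (hρ : 0 ≤ ρ) (hβ : 0 ≤ βx) (hδ₀ : 0 ≤ δ₀)
    (hr : ρ + 2 * (βx * δ₀) ≤ δ) (hs : (etaS i ^ 2 * etaS i ^ 2) * s = 1)
    (hdnn : ∀ a a' : (geo9K i).Site, 0 ≤ (geo9K i).dist a a') (htri : Triangle254 (toB6 (geo9K i) Rr Hp))
    (h261 : Ineq261 d₁ (toB6 (geo9K i) Rr Hp) δ₀ βx) (μ : Fin (d + 1))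
    (hDG : HasMajorant (g := toB6 (geo9K i) Rr Hp) (fun p : SiteY i × ι => ιB (blkOf i.D.toDomains p.1))
      (conj b (diffLetter (shiftY i) (UboxY i U) ((((etaS i : ℝ) : ℂ))⁻¹) (Sum.inl μ)) * conj b ((etaS i ^ 2) • (GpY i (parKnitY i) U).restrictScalars ℝ))
      (fun a a' => A₁ * (geo9K i).len a * Real.exp (-(δ * (geo9K i).dist a a'))))
    (hGm : HasMajorant (g := toB6 (geo9K i) Rr Hp) (fun p : SiteY i × ι => ιB (blkOf i.D.toDomains p.1))
      (conj b ((etaS i ^ 2) • (GpY i (parKnitY i) U).restrictScalars ℝ)) (fun a a' => A * (geo9K i).len a ^ 2 * Real.exp (-(δ * (geo9K i).dist a a'))))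
    (hC : HasMajorant (g := toB6 (geo9K i) Rr Hp) (fun q : BlkY i × ι => ιB q.1)
      (conj b (s • (XinvY i (parKnitY i) (GpY i (parKnitY i)) U).restrictScalars ℝ))
      (fun a a' => K * ((geo9K i).len a ^ 4)⁻¹ * Real.exp (-(δ * (geo9K i).dist a a'))))
    (hrow : ∀ a : (geo9K i).Site, ∑ a' : (geo9K i).Site, Real.exp (-(ρ * (geo9K i).dist a a')) ≤ c)
    (Y : BlkY i → Matrix (Fin N) (Fin N) ℂ) {M : ℝ} (hY : ∀ s, ‖Y s‖ ≤ M) {j : ℕ} (hj : j ≤ n) (z : SiteY i) :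
    (((ℓ + 1 : ℕ) : ℝ)) ^ j *
        ‖cdS i U μ (GpY i (parKnitY i) U (GpY i (parKnitY i) U (QpsY i (parKnitY i) U (XinvY i (parKnitY i) (GpY i (parKnitY i)) U Y)))) z‖
      ≤ (∑ j, ‖b j‖) * (((M₂ * ∑ j, ‖b j‖) * A₁ * A * K * B6.c1 d₁ δ₀ βx ^ 2) * c * (M₂ * M)) := by
  have hη : 0 < etaS i := etaS_pos i
  have hL1 : (1 : ℝ) ≤ ((ℓ + 1 : ℕ) : ℝ) := by exact_mod_cast Nat.succ_le_succ (Nat.zero_le ℓ)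
  have hLn : (0 : ℝ) < (((ℓ + 1 : ℕ) : ℝ)) ^ n := by positivity
  have hpos : (0 : ℝ) < (((ℓ + 1 : ℕ) : ℝ)) ^ i.k := by positivity
  have hlen : ∀ a : (geo9K i).Site, 0 ≤ ((geo9K i).len a)⁻¹ := fun a => by
    rw [geo9K_len_kGeo]; exact inv_nonneg.2 (len_pos i a).le
  have hr' : ρ + 2 * ((0 + βx) * δ₀) ≤ δ := by rw [zero_add]; exact hr
  have hH := hasMajorantHom_conj_gradHprime_parKnitY i b ιB hG hpar hM₂ hrepr d₁ hA₁ hA hK le_rfl hρ le_rfl hβ hδ₀ hr' hs hdnn htri h261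
    (scaleTransfer_of_constLev i hlev δ₀ fun x => x ^ 2) (scaleTransfer_of_constLev i hlev δ₀ fun x => (x ^ 4)⁻¹) μ hDG hGm hC
  have hκ : 0 ≤ (M₂ * ∑ j, ‖b j‖) * A₁ * A * K * (1 : ℝ) ^ 2 * B6.c1 d₁ δ₀ βx ^ 2 := by
    have := c1_nonneg d₁ δ₀ βx
    have : 0 ≤ ∑ j, ‖b j‖ := Finset.sum_nonneg fun _ _ => norm_nonneg _
    positivity
  have h := norm_hom_apply_le_of_hasMajorantHom_exp i b ιB _ hκ hlen hH hrow hM₂ hrepr Y hY z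
  -- the operator applied: `η⁻¹ • ∇_{U,μ}(H′Y)(z)`
  have happ : (gradLetterF (shiftY i) (UboxY i U) ((((etaS i : ℝ) : ℂ))⁻¹) μ ∘ₗ
        (GpY i (parKnitY i) U ∘ₗ GpY i (parKnitY i) U ∘ₗ QpsY i (parKnitY i) U ∘ₗ XinvY i (parKnitY i) (GpY i (parKnitY i)) U).restrictScalars ℝ) Y z
      = ((((etaS i : ℝ) : ℂ))⁻¹) •
          cdS i U μ (GpY i (parKnitY i) U (GpY i (parKnitY i) U (QpsY i (parKnitY i) U (XinvY i (parKnitY i) (GpY i (parKnitY i)) U Y)))) z := by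
    simp only [LinearMap.comp_apply, LinearMap.restrictScalars_apply, gradLetterF_apply]
    rfl
  rw [happ, norm_smul, norm_inv, Complex.norm_real, Real.norm_of_nonneg hη.le, geo9K_len_constLev i hlev, hcf, abs_of_pos hpos, one_pow, mul_one] at h
  -- `(Lⁿ∕L^k)⁻¹ = (Lⁿ·η)⁻¹`
  have hk : nKT (toKT i) = (ℓ + 1) ^ i.k := rfl
  have hq : ((((ℓ + 1 : ℕ) : ℝ)) ^ n / (((ℓ + 1 : ℕ) : ℝ)) ^ i.k)⁻¹ = ((((ℓ + 1 : ℕ) : ℝ)) ^ n * etaS i)⁻¹ := by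
    unfold etaS; rw [hk, div_eq_mul_inv]; push_cast; ring
  rw [hq] at h
  have hjn : (((ℓ + 1 : ℕ) : ℝ)) ^ j ≤ (((ℓ + 1 : ℕ) : ℝ)) ^ n := pow_le_pow_right₀ hL1 hj
  -- `η⁻¹‖∇H′Y‖ ≤ S·(Lⁿη)⁻¹` ⇒ `Lⁿ‖∇H′Y‖ ≤ S` ⇒ `Lʲ‖∇H′Y‖ ≤ S`
  have h2 := scale_aux hLn hη h
  exact le_trans (mul_le_mul_of_nonneg_right hjn (norm_nonneg _)) h2

/-- (E7) in the consumer's letter exactly: with the consumer's `η′ > 0` (`D^{η′}_μ = η′⁻¹∇_μ`, weight `Lʲη′`), `(Lʲη′)·(η′⁻¹·‖(∇_{U,μ}H′Y)(z)‖) ≦ …` for `j ≦ n` —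
the `η′` cancels because `H′` is unit-free. [cite: Balaban1985RegularSpaces, (1.92) p.91, (1.1) p.76; Balaban1985BackgroundPropagators, (3.3) p.390, Thm 3.1 (3.42)₂ p.397] -/
theorem knit_E7_constLev' [Nonempty (Fin N)] {n : ℕ} (hlev : ∀ z : SiteY i, levY i z = n) (hcf : i.cf = (((ℓ + 1 : ℕ) : ℝ)) ^ i.k)
    (hG : G ≤ B7Prop2Explicit.unitaryUnits (Matrix (Fin N) (Fin N) ℂ))
    {U : CfgY (Matrix (Fin N) (Fin N) ℂ) i} (hpar : ∀ z w : SiteY i, parKnitY i U z w ∈ G)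
    {M₂ : ℝ} (hM₂ : 0 ≤ M₂) (hrepr : ∀ (v : Matrix (Fin N) (Fin N) ℂ) (j : ι), |b.repr v j| ≤ M₂ * ‖v‖)
    (d₁ : ℕ) {δ₀ δ βx ρ A₁ A K s c : ℝ} (hA₁ : 0 ≤ A₁) (hA : 0 ≤ A) (hK : 0 ≤ K) (hρ : 0 ≤ ρ) (hβ : 0 ≤ βx) (hδ₀ : 0 ≤ δ₀)
    (hr : ρ + 2 * (βx * δ₀) ≤ δ) (hs : (etaS i ^ 2 * etaS i ^ 2) * s = 1)
    (hdnn : ∀ a a' : (geo9K i).Site, 0 ≤ (geo9K i).dist a a') (htri : Triangle254 (toB6 (geo9K i) Rr Hp))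
    (h261 : Ineq261 d₁ (toB6 (geo9K i) Rr Hp) δ₀ βx) (μ : Fin (d + 1))
    (hDG : HasMajorant (g := toB6 (geo9K i) Rr Hp) (fun p : SiteY i × ι => ιB (blkOf i.D.toDomains p.1))
      (conj b (diffLetter (shiftY i) (UboxY i U) ((((etaS i : ℝ) : ℂ))⁻¹) (Sum.inl μ)) * conj b ((etaS i ^ 2) • (GpY i (parKnitY i) U).restrictScalars ℝ))
      (fun a a' => A₁ * (geo9K i).len a * Real.exp (-(δ * (geo9K i).dist a a'))))
    (hGm : HasMajorant (g := toB6 (geo9K i) Rr Hp) (fun p : SiteY i × ι => ιB (blkOf i.D.toDomains p.1))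
      (conj b ((etaS i ^ 2) • (GpY i (parKnitY i) U).restrictScalars ℝ)) (fun a a' => A * (geo9K i).len a ^ 2 * Real.exp (-(δ * (geo9K i).dist a a'))))
    (hC : HasMajorant (g := toB6 (geo9K i) Rr Hp) (fun q : BlkY i × ι => ιB q.1)
      (conj b (s • (XinvY i (parKnitY i) (GpY i (parKnitY i)) U).restrictScalars ℝ))
      (fun a a' => K * ((geo9K i).len a ^ 4)⁻¹ * Real.exp (-(δ * (geo9K i).dist a a'))))
    (hrow : ∀ a : (geo9K i).Site, ∑ a' : (geo9K i).Site, Real.exp (-(ρ * (geo9K i).dist a a')) ≤ c)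
    {η' : ℝ} (hη' : 0 < η') (Y : BlkY i → Matrix (Fin N) (Fin N) ℂ) {M : ℝ} (hY : ∀ s, ‖Y s‖ ≤ M) {j : ℕ} (hj : j ≤ n) (z : SiteY i) :
    ((((ℓ + 1 : ℕ) : ℝ)) ^ j * η') * (η'⁻¹ *
        ‖cdS i U μ (GpY i (parKnitY i) U (GpY i (parKnitY i) U (QpsY i (parKnitY i) U (XinvY i (parKnitY i) (GpY i (parKnitY i)) U Y)))) z‖)
      ≤ (∑ j, ‖b j‖) * (((M₂ * ∑ j, ‖b j‖) * A₁ * A * K * B6.c1 d₁ δ₀ βx ^ 2) * c * (M₂ * M)) := by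
  have h := knit_E7_constLev i b ιB hlev hcf hG hpar hM₂ hrepr d₁ hA₁ hA hK hρ hβ hδ₀ hr hs hdnn htri h261 μ hDG hGm hC hrow Y hY hj z
  have hne : η' ≠ 0 := hη'.ne'
  calc ((((ℓ + 1 : ℕ) : ℝ)) ^ j * η') * (η'⁻¹ *
        ‖cdS i U μ (GpY i (parKnitY i) U (GpY i (parKnitY i) U (QpsY i (parKnitY i) U (XinvY i (parKnitY i) (GpY i (parKnitY i)) U Y)))) z‖)
      = (((ℓ + 1 : ℕ) : ℝ)) ^ j *
          ‖cdS i U μ (GpY i (parKnitY i) U (GpY i (parKnitY i) U (QpsY i (parKnitY i) U (XinvY i (parKnitY i) (GpY i (parKnitY i)) U Y)))) z‖ := by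
        rw [mul_assoc, mul_inv_cancel_left₀ hne]
    _ ≤ _ := h

end Knit

end Literature.MathematicalPhysics.QuantumFieldTheory.Balaban1983to89.B9B8KnitLetterHprimeBounds

end
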